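import Literature.AnabelianGeometry.EtaleTheta.TemperedFrobenioidOfGaloisCoveringTateTower
import Literature.AnabelianGeometry.EtaleTheta.DivisorMonoidsConstants34
import HarnessLib

/-!
# [EtTh] Prop. 3.4 (ii) «`div₀(c) = v_L(c) · div(ϖ_L)`» — abc-iut-L2-t3's bundle `DivisorMonoids.Prop34Const` — HOLDS at the
# Def. 3.3 (iii) data of the connected coverings of the TATE TOWER (every connected covering, not only `G/G`)

S. Mochizuki, *The étale theta function and its Frobenioid-theoretic manifestations*, Publ. RIMS **45** (2009)
[MochizukiEtTh2009], §3: Prop. 3.4 (ii) PDF p.74 ("the submonoid of `Φ₀` generated by `div₀(ϖ_L)` … `F₀ ⥲ L^×`"),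
Def. 3.3 (iii) p.73 (`Φ₀`, `B₀`, `div₀`), Def. 3.1 (i) p.70 [cite: MochizukiEtTh2009, Prop 3.4 p.74].

abc-iut cell, layer L2, PROOF-ONLY file (theorems only), seat abc-iut-w6-d052 (gen 6), self-named sequel of row R365
(«COR 3.8 (iii) KNIT INSTANTIATED AT A := TateTower.action»; offer «PROP34CONST@TateTower», first refusal abc-iut-w6-d058 /
abc-iut-L2-t3 passed silent).  At abc-iut-w6-d058's Tate tower (`LogDivisorModelTateTower.lean`, p444705: functions
`ϖ^c U^k ↔ (c, k) ∈ ℤ²`, divisor `n ↦ c + k·n` on the chain `ℤ` of special-fibre components, no cusps, constants `{(c, 0)}`,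
`G = ℤ` acting by translation of the chain / shear of `U`) abc-iut-L2-t3's [EtTh] Prop. 3.4 (ii) predicate bundle
`DivisorMonoids.Prop34Const` (`DivisorMonoidsConstants34.lean`; binder `hC` of this seat's Cor. 3.8 (iii) knits p443434 /
p447266 and of abc-iut-L2-d2's apex, GAP-LEDGER G-L2d2-3) is a THEOREM at the Def. 3.3 (iii) data of the CONNECTED coverings
`DivisorMonoids.ofGaloisActionConnected TateTower.action TateTower.cuspLaws`:

* clause (a) is abc-iut-w6-d058's GENERIC `LogDivisorModel.GaloisAction.exists_inv_mem_fZero` (`Sec3Prop34iiOfGaloisCovering`,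
  for every record), consumed BY NAME;
* clause (b), for every CONNECTED covering `S` (nonempty transitive `ℤ`-set): `divZero_eq_zpow_of_forall_eq` — an element of
  `B₀(S)` with constant value `(c, 0)` has `div₀ = c • d` for any `d ∈ Φ₀(S)` with constant value the reduced special fibre
  `Σ_j [F_j]` (abc-iut-w6-d048's `TateTowerFrd.constDIV 1`); `exists_forall_eq_of_mem_fZero` — on a transitive `S` every element
  of `F₀(S)` IS such a constant (equivariance; the shear fixes constants); `exists_specialFibre_phiZero` — clause (b) assembled
  (`d` translation-invariant, non-cuspidal as there are no cusps, `≠ 0`; `ϖ := (1, 0)`);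
* **`LogDivisorModel.TateTower.prop34Const_ofGaloisActionConnected :
  (DivisorMonoids.ofGaloisActionConnected TateTower.action TateTower.cuspLaws).Prop34Const`** — hence, with p447266
  (`LogDivisorModel.TateTower.cor38_iii_ofRankOnePoint … hC`), [EtTh] Cor. 3.8 (iii), first clause, holds with NO hypothesis at
  the tower (stated where both files are imported; this file does not import p447266).

HONEST FRAMING: a computation at a synthetic model (consistency evidence for the cell's typing of §3; the tower is a
`LogDivisorModel` record, not a curve); nothing of [EtTh] asserted; no side taken on [IUTchIII] Cor. 3.12; typed ≠ proved —
here proved.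
-/

namespace Literature.AnabelianGeometry.EtaleTheta

open CategoryTheory Opposite Literature.AlgebraicGeometry.Frobenioids

namespace LogDivisorModel.TateTower

open LogDivisorModel.GaloisAction TateTowerFrd

variable (S : Action (Type 0) (Multiplicative ℤ))

/-! ### Small computations in the tower's function and divisor groups -/

/-- The action of `g ∈ ℤ` on log-divisors of the tower is the translation `shiftDIV`. [cite: MochizukiEtTh2009, Def 3.3 p.73] -/
theorem actDIV_eq_shiftDIV (g : Multiplicative ℤ) (d : TateTower.model.DIV) :
    TateTower.action.actDIV g d = shiftDIV (Multiplicative.toAdd g) d := rfl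

/-- The action of `g ∈ ℤ` on functions of the tower is the shear `shearFn`. [cite: MochizukiEtTh2009, Def 3.3 p.73] -/
theorem actFn_eq_shearFn (g : Multiplicative ℤ) (f : TateTower.model.Fn) :
    TateTower.action.actFn g f = shearFn (Multiplicative.toAdd g) f := rfl

/-- The shear fixes the constants `ϖ^c = (c, 0)`. [cite: MochizukiEtTh2009, Def 3.3 p.73] -/
theorem shearFn_const (t c : ℤ) :
    shearFn t (Multiplicative.ofAdd ((c, 0) : ℤ × ℤ)) = Multiplicative.ofAdd ((c, 0) : ℤ × ℤ) :=
  Multiplicative.toAdd.injective (by rw [toAdd_shearFn]; simp)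

/-- The divisor of the constant `ϖ^c` is `c·Σ_j [F_j]`. [cite: MochizukiEtTh2009, Def 3.1 p.70] -/
theorem divHom_const (c : ℤ) : divHom (Multiplicative.ofAdd ((c, 0) : ℤ × ℤ)) = constDIV c :=
  Multiplicative.toAdd.injective (funext fun x => by rw [toAdd_divHom]; simp [constDIV])

/-- `Σ_j [F_j] ≠ 0`. [cite: MochizukiEtTh2009, Def 3.1 p.70] -/
theorem constDIV_one_ne_one : constDIV 1 ≠ 1 := fun h => by
  have := congrArg (fun d => val d (Sum.inr 0)) h
  rw [val_constDIV] at this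
  exact one_ne_zero this

/-- `constDIV` is additive in the exponent: `constDIV (m + n) = constDIV m * constDIV n`. [cite: MochizukiEtTh2009, Def 3.1 p.70] -/
theorem constDIV_add (m n : ℤ) : constDIV (m + n) = constDIV m * constDIV n :=
  Multiplicative.toAdd.injective (funext fun _ => rfl)

/-- `constDIV (-n) * constDIV n = 1`. [cite: MochizukiEtTh2009, Def 3.1 p.70] -/
theorem constDIV_neg_mul (n : ℤ) : constDIV (-n) * constDIV n = 1 := by
  rw [← constDIV_add, neg_add_cancel]
  exact Multiplicative.toAdd.injective (funext fun _ => rfl)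

/-- Powers of `Σ_j [F_j]`: `(constDIV 1)^n = constDIV n`. [cite: MochizukiEtTh2009, Def 3.1 p.70] -/
theorem constDIV_one_pow (n : ℕ) : constDIV 1 ^ n = constDIV n := by
  induction n with
  | zero => exact Multiplicative.toAdd.injective (funext fun _ => rfl)
  | succ n ih => rw [pow_succ, ih, ← constDIV_add]; push_cast; rfl

/-! ### The reduced special fibre in `Φ₀(S)` and the constants in `B₀(S)`, for every `ℤ`-set `S` -/

/-- **The reduced special fibre as an element of `Φ₀(S)` for EVERY `ℤ`-set `S`**: the constant function `Σ_j [F_j]`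
(effective Cartier, translation-invariant). [cite: MochizukiEtTh2009, Def 3.3 p.73] -/
theorem constDIV_one_mem_phiZero :
    (fun _ : S.V => (constDIV 1 : TateTower.model.DIV)) ∈ TateTower.action.phiZero S :=
  ⟨fun _ => constDIV_mem_Divplus 1, fun g _ => by
    rw [actDIV_eq_shiftDIV, shiftDIV_constDIV]⟩

/-- **The constant `ϖ^c = (c, 0)` as an element of `B₀(S)`** for every `ℤ`-set `S` (log-meromorphic, shear-invariant).
[cite: MochizukiEtTh2009, Def 3.3 p.73] -/
theorem const_mem_bZero (c : ℤ) :
    (fun _ : S.V => (Multiplicative.ofAdd ((c, 0) : ℤ × ℤ) : TateTower.model.Fn)) ∈ TateTower.action.bZero S :=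
  ⟨fun _ => trivial, fun g _ => by
    change Multiplicative.ofAdd ((c, 0) : ℤ × ℤ) =
      shearFn (Multiplicative.toAdd g) (Multiplicative.ofAdd ((c, 0) : ℤ × ℤ))
    rw [shearFn_const]⟩

/-- `(c, 0)` is a constant of the tower (`L^× = {ϖ^c}`). [cite: MochizukiEtTh2009, Def 3.1 p.70] -/
theorem ofAdd_const_mem_const (c : ℤ) : (Multiplicative.ofAdd ((c, 0) : ℤ × ℤ) : TateTower.model.Fn) ∈ TateTower.model.const :=
  ⟨Multiplicative.ofAdd c, rfl⟩

/-- A constant of the tower is `(c, 0)` for some `c ∈ ℤ`. [cite: MochizukiEtTh2009, Def 3.1 p.70] -/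
theorem exists_eq_ofAdd_of_mem_const {f : TateTower.model.Fn} (hf : f ∈ TateTower.model.const) :
    ∃ c : ℤ, f = Multiplicative.ofAdd ((c, 0) : ℤ × ℤ) := by
  obtain ⟨c, rfl⟩ := hf
  exact ⟨Multiplicative.toAdd c, rfl⟩

/-- The divisor of `b ∈ B₀(S)` at `s` is `div(b s) = divHom (b s)` at the tower, so a constant value `(c, 0)` gives
`c·Σ_j [F_j]`. [cite: MochizukiEtTh2009, Def 3.3 p.73] -/
theorem divAt_eq_constDIV (b : TateTower.action.bZero S) (s : S.V) (c : ℤ)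
    (hc : b.1 s = Multiplicative.ofAdd ((c, 0) : ℤ × ℤ)) :
    TateTower.action.divAt S b s = constDIV c := by
  change divHom (b.1 s) = constDIV c
  rw [hc]
  exact divHom_const c

/-! ### Clause (b) at the tower -/

/-- **`div₀` of a constant-valued element of `B₀(S)`**: if `b s = (c, 0)` for every `s`, then `div₀ b = [d]^c` in `Φ₀(S)^gp`
for any `d ∈ Φ₀(S)` with constant value `Σ_j [F_j]` (both signs of `c`, via abc-iut-w6-d058's characterisation
`divZero_eq_div_iff`). [cite: MochizukiEtTh2009, Prop 3.4 p.74] -/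
theorem divZero_eq_zpow_of_forall_eq (d : TateTower.action.phiZero S)
    (hd : ∀ s, d.1 s = (constDIV 1 : TateTower.model.DIV)) (b : TateTower.action.bZero S) (c : ℤ)
    (hc : ∀ s, b.1 s = Multiplicative.ofAdd ((c, 0) : ℤ × ℤ)) :
    TateTower.action.divZero S b = Algebra.GrothendieckGroup.of d ^ c := by
  have hdpow : ∀ (n : ℕ) s, (d ^ n).1 s = (constDIV n : TateTower.model.DIV) := fun n s => by
    rw [SubmonoidClass.coe_pow, Pi.pow_apply, hd]
    exact constDIV_one_pow n
  obtain ⟨n, rfl | rfl⟩ := Int.eq_nat_or_neg c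
  · -- `c = n ≥ 0`: `div₀ b = [dⁿ] / [1]`
    rw [zpow_natCast, ← map_pow, ← div_one (Algebra.GrothendieckGroup.of (d ^ n)),
      ← map_one Algebra.GrothendieckGroup.of, TateTower.action.divZero_eq_div_iff]
    intro s
    rw [divAt_eq_constDIV S b s n (hc s), OneMemClass.coe_one, Pi.one_apply, mul_one, hdpow]
  · -- `c = -n ≤ 0`: `div₀ b = [1] / [dⁿ]`
    rw [zpow_neg, zpow_natCast, ← map_pow, ← one_div, ← map_one Algebra.GrothendieckGroup.of,
      TateTower.action.divZero_eq_div_iff]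
    intro s
    rw [divAt_eq_constDIV S b s (-n) (hc s), OneMemClass.coe_one, Pi.one_apply, hdpow]
    exact constDIV_neg_mul n

/-- **On a TRANSITIVE `ℤ`-set a constant-valued equivariant function is constant**: `b ∈ F₀(S)` takes ONE value `(c, 0)`.
[cite: MochizukiEtTh2009, Prop 3.4 p.74] -/
theorem exists_forall_eq_of_mem_fZero (hS : ∀ s t : S.V, ∃ g : Multiplicative ℤ, S.ρ g s = t) (s₀ : S.V)
    (b : TateTower.action.bZero S) (hb : b ∈ TateTower.action.fZero S) :
    ∃ c : ℤ, ∀ s, b.1 s = Multiplicative.ofAdd ((c, 0) : ℤ × ℤ) := by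
  obtain ⟨c, hc⟩ := exists_eq_ofAdd_of_mem_const (hb s₀)
  refine ⟨c, fun s => ?_⟩
  obtain ⟨g, rfl⟩ := hS s₀ s
  rw [b.2.2 g s₀, hc, actFn_eq_shearFn]
  exact shearFn_const _ c

/-- **Clause (b) of `Prop34Const` at the tower, for every CONNECTED covering `S`**: `d := Σ_j [F_j] ∈ Φ₀(S)` is non-cuspidal,
`≠ 0`, equals `div₀(ϖ)` for the constant `ϖ = (1,0) ∈ F₀(S)`, and `div₀(b) = c • d` for every `b = (c, 0) ∈ F₀(S)`.
[cite: MochizukiEtTh2009, Prop 3.4 p.74] -/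
theorem exists_specialFibre_phiZero (hS : isConnectedGSet S) :
    ∃ d ∈ TateTower.action.ncspZero S, d ≠ 1 ∧
      (∃ ϖ ∈ TateTower.action.fZero S, TateTower.action.divZeroHom S ϖ = Algebra.GrothendieckGroup.of d) ∧
      ∀ b ∈ TateTower.action.fZero S, ∃ n : ℤ, TateTower.action.divZeroHom S b = Algebra.GrothendieckGroup.of d ^ n := by
  obtain ⟨⟨s₀⟩, htrans⟩ := hS
  let d : TateTower.action.phiZero S := ⟨_, constDIV_one_mem_phiZero S⟩
  have hd : ∀ s, d.1 s = (constDIV 1 : TateTower.model.DIV) := fun _ => rfl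
  refine ⟨d, fun _ => trivial, fun h => constDIV_one_ne_one ((hd s₀).symm.trans (by rw [h]; rfl)), ?_, ?_⟩
  · -- `ϖ = (1, 0)`
    refine ⟨⟨_, const_mem_bZero S 1⟩, fun _ => ofAdd_const_mem_const 1, ?_⟩
    have h := divZero_eq_zpow_of_forall_eq S d hd ⟨_, const_mem_bZero S 1⟩ 1 fun _ => rfl
    rw [zpow_one] at h
    exact h
  · -- every `b ∈ F₀(S)` is `(c, 0)`
    intro b hb
    obtain ⟨c, hc⟩ := exists_forall_eq_of_mem_fZero S htrans s₀ b hb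
    exact ⟨c, divZero_eq_zpow_of_forall_eq S d hd b c hc⟩

/-- **[EtTh] Prop. 3.4 (ii), abc-iut-L2-t3's bundle `Prop34Const`, HOLDS at the Def. 3.3 (iii) data of the CONNECTED coverings
of the Tate tower** — clause (a) by abc-iut-w6-d058's generic `exists_inv_mem_fZero`, clause (b) by `exists_specialFibre_phiZero`;
the binder `hC` of this seat's Cor. 3.8 (iii) knits (p443434 / p447266) and of abc-iut-L2-d2's apex is a THEOREM there.
[cite: MochizukiEtTh2009, Prop 3.4 p.74] -/
theorem prop34Const_ofGaloisActionConnected :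
    (DivisorMonoids.ofGaloisActionConnected TateTower.action TateTower.cuspLaws).Prop34Const where
  inv_mem_F₀ Y b hb := exists_inv_mem_fZero TateTower.action Y.unop.obj b hb
  exists_specialFibre Y := exists_specialFibre_phiZero Y.unop.obj Y.unop.property

end LogDivisorModel.TateTower

end Literature.AnabelianGeometry.EtaleTheta
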